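import Mathlib
import Summits.ValiantsHypothesis.ValiantsHypothesis.Theorems.ValuativeGCTValuativeFlipPencilBorderTools

/-!
# The SECOND-ORDER bordering transfer for four-variable permanental pencil ranks
# (crux `ValuativeGCT.ValuativeFlip`, stmt-ValiantsHypothesis-12624; wall-breaker axis k8 gen 1)

Helper file (`--supports stmt-ValiantsHypothesis-12624`), line `four-row-count`, `m`-free heart `H` of
`stub_fourRowPencilRank`.  This is `pencilRank_border_transfer` (`…PencilBorder`) with the `2(n+1)`
SECOND-ORDER generators added: writing the products of the bordered pencil `M' = [[M,u],[vᵀ,w/μ]]`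
as the affine family `G(μ)` (old-block minors multiplied by `μ`), every linear relation `c` among the
values `G(0)` yields the extra element `(1/μ)·Σ c_i G_i(μ) = Σ c_i G¹_i` of the product span; the
universal relations `w · (y ⊗ R_k) ∈ w · V(M)` (`R_k = Σ_l v_l Per_{kl}(M)`, one for each old row, and
one for each old column) give
  `Z_k = Σ_l v_l · Q_{kl}`,  `Z'_l = Σ_k u_k · Q_{kl}`,   `Q_{kl} = Per_{kl}([[M,u],[vᵀ,0]])`
(permanents of the corner-free bordered pencil with one old row, resp. column, replaced by the border
row, resp. column).  Hence (`pencilRank_border_transfer2`) for some `c ≠ 0`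
  `s([[M,u],[vᵀ,c·w]]) ≥ dim( w·V(M) + ⟨y_t per M⟩ + ⟨y_t R_k⟩ + ⟨y_t C_l⟩ + ⟨Z_k⟩ + ⟨Z'_l⟩ )`.
Numerically (seat folder `compute/pattern2.c`, exact ranks mod `2⁶¹-1`) the right-hand side restricted
to `y₄ = 0` has rank EXACTLY `8N + 2` — the full generic increment of `4N² - 2N + 2` — both for random
data and for the explicit affine pattern `b_ij = y₁ + i·y₂ + j·y₃` (zero diagonal), `N = 11 … 14`
(below that it is the whole ambient space of ternary forms).  [this crux, line four-row-count; folklore]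
-/

set_option linter.dupNamespace false

namespace Summit.ValiantsHypothesis.ValiantsHypothesis.Theorems.ValuativeFlip

open scoped BigOperators Matrix
open MvPolynomial Literature.Computability.AlgebraicComplexity

/-- **Second-order bordering transfer** (inner size `n+1 → n+2`).  As `pencilRank_border_transfer`,
with a corner-free extension `M₀ = [[M,u],[vᵀ,0]]` given by equations and the second-order generators
`Z_k = Σ_l v_l · (∂_{kl} per_{n+2})(M₀)`, `Z'_l = Σ_k u_k · (∂_{kl} per_{n+2})(M₀)` added to the
displayed space. [this crux, line four-row-count; folklore] -/
theorem pencilRank_border_transfer2 (n : ℕ) (M : Fin (n + 1) × Fin (n + 1) → Fin 4 → ℂ)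
    (u v : Fin (n + 1) → Fin 4 → ℂ) (w : Fin 4 → ℂ) (M₀ : Fin (n + 2) × Fin (n + 2) → Fin 4 → ℂ)
    (h₀₁₁ : ∀ i j, M₀ (Fin.castSucc i, Fin.castSucc j) = M (i, j))
    (h₀₁₂ : ∀ i, M₀ (Fin.castSucc i, Fin.last (n + 1)) = u i)
    (h₀₂₁ : ∀ j, M₀ (Fin.last (n + 1), Fin.castSucc j) = v j)
    (h₀₂₂ : M₀ (Fin.last (n + 1), Fin.last (n + 1)) = 0) :
    ∃ (c : ℂ) (M' : Fin (n + 2) × Fin (n + 2) → Fin 4 → ℂ), c ≠ 0 ∧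
      (∀ i j, M' (Fin.castSucc i, Fin.castSucc j) = M (i, j)) ∧
      (∀ i, M' (Fin.castSucc i, Fin.last (n + 1)) = u i) ∧
      (∀ j, M' (Fin.last (n + 1), Fin.castSucc j) = v j) ∧
      M' (Fin.last (n + 1), Fin.last (n + 1)) = c • w ∧
      Module.finrank ℂ ↥(
        (Submodule.span ℂ (Set.range fun tc : Fin 4 × (Fin (n + 1) × Fin (n + 1)) =>
          (X tc.1 : MvPolynomial (Fin 4) ℂ) *
            aeval (fun ij : Fin (n + 1) × Fin (n + 1) => ∑ t : Fin 4, M ij t • (X t : MvPolynomial (Fin 4) ℂ))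
              (pderiv tc.2 (perPoly (Fin (n + 1)) ℂ)))).map
          (LinearMap.mulLeft ℂ (∑ t : Fin 4, w t • (X t : MvPolynomial (Fin 4) ℂ)))
        ⊔ Submodule.span ℂ (Set.range fun t : Fin 4 =>
          (X t : MvPolynomial (Fin 4) ℂ) *
            aeval (fun ij : Fin (n + 1) × Fin (n + 1) => ∑ t : Fin 4, M ij t • (X t : MvPolynomial (Fin 4) ℂ))
              (perPoly (Fin (n + 1)) ℂ))
        ⊔ Submodule.span ℂ (Set.range fun tk : Fin 4 × Fin (n + 1) =>
          (X tk.1 : MvPolynomial (Fin 4) ℂ) *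
            ∑ l : Fin (n + 1), (∑ t : Fin 4, v l t • (X t : MvPolynomial (Fin 4) ℂ)) *
              aeval (fun ij : Fin (n + 1) × Fin (n + 1) => ∑ t : Fin 4, M ij t • (X t : MvPolynomial (Fin 4) ℂ))
                (pderiv (tk.2, l) (perPoly (Fin (n + 1)) ℂ)))
        ⊔ Submodule.span ℂ (Set.range fun tl : Fin 4 × Fin (n + 1) =>
          (X tl.1 : MvPolynomial (Fin 4) ℂ) *
            ∑ k : Fin (n + 1), (∑ t : Fin 4, u k t • (X t : MvPolynomial (Fin 4) ℂ)) *
              aeval (fun ij : Fin (n + 1) × Fin (n + 1) => ∑ t : Fin 4, M ij t • (X t : MvPolynomial (Fin 4) ℂ))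
                (pderiv (k, tl.2) (perPoly (Fin (n + 1)) ℂ)))
        ⊔ Submodule.span ℂ (Set.range fun k : Fin (n + 1) =>
            ∑ l : Fin (n + 1), (∑ t : Fin 4, v l t • (X t : MvPolynomial (Fin 4) ℂ)) *
              aeval (fun ij : Fin (n + 2) × Fin (n + 2) => ∑ t : Fin 4, M₀ ij t • (X t : MvPolynomial (Fin 4) ℂ))
                (pderiv (Fin.castSucc k, Fin.castSucc l) (perPoly (Fin (n + 2)) ℂ)))
        ⊔ Submodule.span ℂ (Set.range fun l : Fin (n + 1) =>
            ∑ k : Fin (n + 1), (∑ t : Fin 4, u k t • (X t : MvPolynomial (Fin 4) ℂ)) *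
              aeval (fun ij : Fin (n + 2) × Fin (n + 2) => ∑ t : Fin 4, M₀ ij t • (X t : MvPolynomial (Fin 4) ℂ))
                (pderiv (Fin.castSucc k, Fin.castSucc l) (perPoly (Fin (n + 2)) ℂ)))) ≤
      Module.finrank ℂ ↥(Submodule.span ℂ (Set.range fun tc : Fin 4 × (Fin (n + 2) × Fin (n + 2)) =>
          (X tc.1 : MvPolynomial (Fin 4) ℂ) *
            aeval (fun ij : Fin (n + 2) × Fin (n + 2) => ∑ t : Fin 4, M' ij t • (X t : MvPolynomial (Fin 4) ℂ))
              (pderiv tc.2 (perPoly (Fin (n + 2)) ℂ)))) := by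
  classical
  -- linear forms and the pencil matrix of `M`
  set lin : (Fin 4 → ℂ) → MvPolynomial (Fin 4) ℂ := fun a => ∑ t : Fin 4, a t • (X t : MvPolynomial (Fin 4) ℂ)
    with hlin
  have hlin_smul : ∀ (c : ℂ) (a : Fin 4 → ℂ), lin (c • a) = c • lin a := by
    intro c a
    simp only [hlin, Pi.smul_apply, smul_eq_mul, Finset.smul_sum, smul_smul]
  have hlin_zero : lin 0 = 0 := by simp [hlin]
  set A : Matrix (Fin (n + 1)) (Fin (n + 1)) (MvPolynomial (Fin 4) ℂ) :=
    Matrix.of fun i j => lin (M (i, j)) with hA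
  -- the bordered pencils, one for each corner scale
  let bord : ℂ → (Fin (n + 2) × Fin (n + 2) → Fin 4 → ℂ) := fun c p =>
    Fin.snoc (α := fun _ => Fin 4 → ℂ)
      (fun i : Fin (n + 1) => (Fin.snoc (α := fun _ => Fin 4 → ℂ) (fun j : Fin (n + 1) => M (i, j)) (u i)
        : Fin (n + 2) → Fin 4 → ℂ) p.2)
      ((Fin.snoc (α := fun _ => Fin 4 → ℂ) v (c • w) : Fin (n + 2) → Fin 4 → ℂ) p.2) p.1
  have hb11 : ∀ c i j, bord c (Fin.castSucc i, Fin.castSucc j) = M (i, j) := by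
    intro c i j; simp [bord]
  have hb12 : ∀ c i, bord c (Fin.castSucc i, Fin.last (n + 1)) = u i := by
    intro c i; simp [bord]
  have hb21 : ∀ c j, bord c (Fin.last (n + 1), Fin.castSucc j) = v j := by
    intro c j; simp [bord]
  have hb22 : ∀ c, bord c (Fin.last (n + 1), Fin.last (n + 1)) = c • w := by
    intro c; simp [bord]
  -- their pencil matrices
  let B : ℂ → Matrix (Fin (n + 2)) (Fin (n + 2)) (MvPolynomial (Fin 4) ℂ) := fun c =>
    Matrix.of fun I J => lin (bord c (I, J))
  have hBA : ∀ c i j, B c (Fin.castSucc i) (Fin.castSucc j) = A i j := by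
    intro c i j; simp only [B, Matrix.of_apply, hb11, hA]
  have hBu : ∀ c i, B c (Fin.castSucc i) (Fin.last (n + 1)) = lin (u i) := by
    intro c i; simp only [B, Matrix.of_apply, hb12]
  have hBv : ∀ c j, B c (Fin.last (n + 1)) (Fin.castSucc j) = lin (v j) := by
    intro c j; simp only [B, Matrix.of_apply, hb21]
  have hBw : ∀ c, B c (Fin.last (n + 1)) (Fin.last (n + 1)) = c • lin w := by
    intro c; simp only [B, Matrix.of_apply, hb22, hlin_smul]
  have hrows : ∀ c i j, B 0 (Fin.castSucc i) j = B c (Fin.castSucc i) j := by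
    intro c i j
    refine Fin.lastCases ?_ (fun j' => ?_) j
    · rw [hBu, hBu]
    · rw [hBA, hBA]
  have hlastrow : ∀ c j, B 0 (Fin.last (n + 1)) (Fin.castSucc j) = B c (Fin.last (n + 1)) (Fin.castSucc j) := by
    intro c j; rw [hBv, hBv]
  have hcorner0 : B 0 (Fin.last (n + 1)) (Fin.last (n + 1)) = 0 := by
    rw [hBw, zero_smul]
  -- minors of the pencils as values of `∂ per`
  have hminor : ∀ k l : Fin (n + 1),
      aeval (fun ij : Fin (n + 1) × Fin (n + 1) => ∑ t : Fin 4, M ij t • (X t : MvPolynomial (Fin 4) ℂ))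
        (pderiv (k, l) (perPoly (Fin (n + 1)) ℂ)) = (A.submatrix k.succAbove l.succAbove).permanent := by
    intro k l
    rw [pb_aeval_pderiv_perPoly]
  have hper : aeval (fun ij : Fin (n + 1) × Fin (n + 1) => ∑ t : Fin 4, M ij t • (X t : MvPolynomial (Fin 4) ℂ))
      (perPoly (Fin (n + 1)) ℂ) = A.permanent := by
    rw [pb_aeval_perPoly]
  have hminor' : ∀ c (K L : Fin (n + 2)),
      aeval (fun ij : Fin (n + 2) × Fin (n + 2) => ∑ t : Fin 4, bord c ij t • (X t : MvPolynomial (Fin 4) ℂ))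
        (pderiv (K, L) (perPoly (Fin (n + 2)) ℂ)) = ((B c).submatrix K.succAbove L.succAbove).permanent := by
    intro c K L
    rw [pb_aeval_pderiv_perPoly]
  -- the corner-free extension `M₀` and the second-order minors `Q_{kl}`
  have hQ : ∀ k l : Fin (n + 1),
      aeval (fun ij : Fin (n + 2) × Fin (n + 2) => ∑ t : Fin 4, M₀ ij t • (X t : MvPolynomial (Fin 4) ℂ))
        (pderiv (Fin.castSucc k, Fin.castSucc l) (perPoly (Fin (n + 2)) ℂ)) =
      ((B 0).submatrix (Fin.castSucc k).succAbove (Fin.castSucc l).succAbove).permanent := by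
    intro k l
    rw [pb_aeval_pderiv_perPoly]
    have hd := pb_permanent_submatrix_castSucc_castSucc (B 0)
      (Matrix.of fun i j => ∑ t : Fin 4, M₀ (i, j) t • (X t : MvPolynomial (Fin 4) ℂ)) A (hBA 0)
      (fun i j => ?_) (fun j => ?_) ?_ k l
    · rw [hd, hBw, zero_smul, zero_mul, zero_add]
    · refine Fin.lastCases ?_ (fun j' => ?_) j
      · rw [hBu, Matrix.of_apply, h₀₁₂]
      · rw [hBA, Matrix.of_apply, h₀₁₁, hA, Matrix.of_apply]
    · rw [hBv, Matrix.of_apply, h₀₂₁]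
    · rw [Matrix.of_apply, h₀₂₂]; simp
  -- finite-dimensionality of the target span
  haveI hfinV : ∀ c, Module.Finite ℂ ↥(Submodule.span ℂ (Set.range fun tc : Fin 4 × (Fin (n + 2) × Fin (n + 2)) =>
      (X tc.1 : MvPolynomial (Fin 4) ℂ) *
        aeval (fun ij : Fin (n + 2) × Fin (n + 2) => ∑ t : Fin 4, bord c ij t • (X t : MvPolynomial (Fin 4) ℂ))
          (pderiv tc.2 (perPoly (Fin (n + 2)) ℂ)))) := fun c =>
    Module.Finite.span_of_finite ℂ (Set.finite_range _)
  -- generators of the target span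
  have hgen : ∀ c (t : Fin 4) (K L : Fin (n + 2)),
      (X t : MvPolynomial (Fin 4) ℂ) * ((B c).submatrix K.succAbove L.succAbove).permanent ∈
        Submodule.span ℂ (Set.range fun tc : Fin 4 × (Fin (n + 2) × Fin (n + 2)) =>
          (X tc.1 : MvPolynomial (Fin 4) ℂ) *
            aeval (fun ij : Fin (n + 2) × Fin (n + 2) => ∑ t : Fin 4, bord c ij t • (X t : MvPolynomial (Fin 4) ℂ))
              (pderiv tc.2 (perPoly (Fin (n + 2)) ℂ))) := by
    intro c t K L
    rw [← hminor' c K L]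
    exact Submodule.subset_span ⟨(t, (K, L)), rfl⟩
  -- the affine family: value at `μ = 0` spans the displayed space, value at `μ` lies in the target
  let F₁ : Fin 4 × (Fin (n + 1) × Fin (n + 1)) → MvPolynomial (Fin 4) ℂ := fun tc =>
    lin w * ((X tc.1 : MvPolynomial (Fin 4) ℂ) *
      aeval (fun ij : Fin (n + 1) × Fin (n + 1) => ∑ t : Fin 4, M ij t • (X t : MvPolynomial (Fin 4) ℂ))
        (pderiv tc.2 (perPoly (Fin (n + 1)) ℂ)))
  let F₂ : Fin 4 → MvPolynomial (Fin 4) ℂ := fun t =>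
    (X t : MvPolynomial (Fin 4) ℂ) *
      aeval (fun ij : Fin (n + 1) × Fin (n + 1) => ∑ t : Fin 4, M ij t • (X t : MvPolynomial (Fin 4) ℂ))
        (perPoly (Fin (n + 1)) ℂ)
  let F₃ : Fin 4 × Fin (n + 1) → MvPolynomial (Fin 4) ℂ := fun tk =>
    (X tk.1 : MvPolynomial (Fin 4) ℂ) *
      ∑ l : Fin (n + 1), (∑ t : Fin 4, v l t • (X t : MvPolynomial (Fin 4) ℂ)) *
        aeval (fun ij : Fin (n + 1) × Fin (n + 1) => ∑ t : Fin 4, M ij t • (X t : MvPolynomial (Fin 4) ℂ))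
          (pderiv (tk.2, l) (perPoly (Fin (n + 1)) ℂ))
  let F₄ : Fin 4 × Fin (n + 1) → MvPolynomial (Fin 4) ℂ := fun tl =>
    (X tl.1 : MvPolynomial (Fin 4) ℂ) *
      ∑ k : Fin (n + 1), (∑ t : Fin 4, u k t • (X t : MvPolynomial (Fin 4) ℂ)) *
        aeval (fun ij : Fin (n + 1) × Fin (n + 1) => ∑ t : Fin 4, M ij t • (X t : MvPolynomial (Fin 4) ℂ))
          (pderiv (k, tl.2) (perPoly (Fin (n + 1)) ℂ))
  let FZ : Fin (n + 1) → MvPolynomial (Fin 4) ℂ := fun k =>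
    ∑ l : Fin (n + 1), lin (v l) *
      aeval (fun ij : Fin (n + 2) × Fin (n + 2) => ∑ t : Fin 4, M₀ ij t • (X t : MvPolynomial (Fin 4) ℂ))
        (pderiv (Fin.castSucc k, Fin.castSucc l) (perPoly (Fin (n + 2)) ℂ))
  let FZ' : Fin (n + 1) → MvPolynomial (Fin 4) ℂ := fun l =>
    ∑ k : Fin (n + 1), lin (u k) *
      aeval (fun ij : Fin (n + 2) × Fin (n + 2) => ∑ t : Fin 4, M₀ ij t • (X t : MvPolynomial (Fin 4) ℂ))
        (pderiv (Fin.castSucc k, Fin.castSucc l) (perPoly (Fin (n + 2)) ℂ))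
  let G₀ : ((Fin 4 × (Fin (n + 1) × Fin (n + 1))) ⊕ (Fin 4 ⊕ ((Fin 4 × Fin (n + 1)) ⊕ (Fin 4 × Fin (n + 1))))) ⊕
      (Fin (n + 1) ⊕ Fin (n + 1)) → MvPolynomial (Fin 4) ℂ :=
    Sum.elim (Sum.elim F₁ (Sum.elim F₂ (Sum.elim F₃ F₄))) (Sum.elim FZ FZ')
  let Q₁ : Fin 4 × (Fin (n + 1) × Fin (n + 1)) → MvPolynomial (Fin 4) ℂ := fun tc =>
    (X tc.1 : MvPolynomial (Fin 4) ℂ) *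
      ((B 0).submatrix (Fin.castSucc tc.2.1).succAbove (Fin.castSucc tc.2.2).succAbove).permanent
  let G₁ : ((Fin 4 × (Fin (n + 1) × Fin (n + 1))) ⊕ (Fin 4 ⊕ ((Fin 4 × Fin (n + 1)) ⊕ (Fin 4 × Fin (n + 1))))) ⊕
      (Fin (n + 1) ⊕ Fin (n + 1)) → MvPolynomial (Fin 4) ℂ :=
    Sum.elim (Sum.elim Q₁ 0) 0
  obtain ⟨μ, hμ0, hμ⟩ := pb_exists_ne_zero_finrank_le (K := ℂ) G₀ G₁
  refine ⟨μ⁻¹, bord μ⁻¹, inv_ne_zero hμ0, hb11 _, hb12 _, hb21 _, hb22 _, ?_⟩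
  -- (1) the displayed space is contained in `span (range G₀)`
  haveI : Module.Finite ℂ ↥(Submodule.span ℂ (Set.range G₀)) :=
    Module.Finite.span_of_finite ℂ (Set.finite_range _)
  have hG₀ : ∀ i, G₀ i ∈ Submodule.span ℂ (Set.range G₀) := fun i => Submodule.subset_span ⟨i, rfl⟩
  have hN : (Submodule.span ℂ (Set.range fun tc : Fin 4 × (Fin (n + 1) × Fin (n + 1)) =>
          (X tc.1 : MvPolynomial (Fin 4) ℂ) *
            aeval (fun ij : Fin (n + 1) × Fin (n + 1) => ∑ t : Fin 4, M ij t • (X t : MvPolynomial (Fin 4) ℂ))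
              (pderiv tc.2 (perPoly (Fin (n + 1)) ℂ)))).map
          (LinearMap.mulLeft ℂ (∑ t : Fin 4, w t • (X t : MvPolynomial (Fin 4) ℂ)))
        ⊔ Submodule.span ℂ (Set.range fun t : Fin 4 =>
          (X t : MvPolynomial (Fin 4) ℂ) *
            aeval (fun ij : Fin (n + 1) × Fin (n + 1) => ∑ t : Fin 4, M ij t • (X t : MvPolynomial (Fin 4) ℂ))
              (perPoly (Fin (n + 1)) ℂ))
        ⊔ Submodule.span ℂ (Set.range fun tk : Fin 4 × Fin (n + 1) =>
          (X tk.1 : MvPolynomial (Fin 4) ℂ) *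
            ∑ l : Fin (n + 1), (∑ t : Fin 4, v l t • (X t : MvPolynomial (Fin 4) ℂ)) *
              aeval (fun ij : Fin (n + 1) × Fin (n + 1) => ∑ t : Fin 4, M ij t • (X t : MvPolynomial (Fin 4) ℂ))
                (pderiv (tk.2, l) (perPoly (Fin (n + 1)) ℂ)))
        ⊔ Submodule.span ℂ (Set.range fun tl : Fin 4 × Fin (n + 1) =>
          (X tl.1 : MvPolynomial (Fin 4) ℂ) *
            ∑ k : Fin (n + 1), (∑ t : Fin 4, u k t • (X t : MvPolynomial (Fin 4) ℂ)) *
              aeval (fun ij : Fin (n + 1) × Fin (n + 1) => ∑ t : Fin 4, M ij t • (X t : MvPolynomial (Fin 4) ℂ))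
                (pderiv (k, tl.2) (perPoly (Fin (n + 1)) ℂ)))
        ⊔ Submodule.span ℂ (Set.range fun k : Fin (n + 1) =>
            ∑ l : Fin (n + 1), (∑ t : Fin 4, v l t • (X t : MvPolynomial (Fin 4) ℂ)) *
              aeval (fun ij : Fin (n + 2) × Fin (n + 2) => ∑ t : Fin 4, M₀ ij t • (X t : MvPolynomial (Fin 4) ℂ))
                (pderiv (Fin.castSucc k, Fin.castSucc l) (perPoly (Fin (n + 2)) ℂ)))
        ⊔ Submodule.span ℂ (Set.range fun l : Fin (n + 1) =>
            ∑ k : Fin (n + 1), (∑ t : Fin 4, u k t • (X t : MvPolynomial (Fin 4) ℂ)) *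
              aeval (fun ij : Fin (n + 2) × Fin (n + 2) => ∑ t : Fin 4, M₀ ij t • (X t : MvPolynomial (Fin 4) ℂ))
                (pderiv (Fin.castSucc k, Fin.castSucc l) (perPoly (Fin (n + 2)) ℂ))) ≤
      Submodule.span ℂ (Set.range G₀) := by
    refine sup_le (sup_le (sup_le (sup_le (sup_le ?_ ?_) ?_) ?_) ?_) ?_
    · rw [Submodule.map_le_iff_le_comap, Submodule.span_le]
      rintro _ ⟨tc, rfl⟩
      exact hG₀ (Sum.inl (Sum.inl tc))
    · rw [Submodule.span_le]
      rintro _ ⟨t, rfl⟩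
      exact hG₀ (Sum.inl (Sum.inr (Sum.inl t)))
    · rw [Submodule.span_le]
      rintro _ ⟨tk, rfl⟩
      exact hG₀ (Sum.inl (Sum.inr (Sum.inr (Sum.inl tk))))
    · rw [Submodule.span_le]
      rintro _ ⟨tl, rfl⟩
      exact hG₀ (Sum.inl (Sum.inr (Sum.inr (Sum.inr tl))))
    · rw [Submodule.span_le]
      rintro _ ⟨k, rfl⟩
      exact hG₀ (Sum.inr (Sum.inl k))
    · rw [Submodule.span_le]
      rintro _ ⟨l, rfl⟩
      exact hG₀ (Sum.inr (Sum.inr l))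
  -- (2) the value at `μ` lies in the product span of the bordered pencil with corner scale `μ⁻¹`
  have hGμ : Submodule.span ℂ (Set.range fun i => G₀ i + μ • G₁ i) ≤
      Submodule.span ℂ (Set.range fun tc : Fin 4 × (Fin (n + 2) × Fin (n + 2)) =>
          (X tc.1 : MvPolynomial (Fin 4) ℂ) *
            aeval (fun ij : Fin (n + 2) × Fin (n + 2) => ∑ t : Fin 4, bord μ⁻¹ ij t • (X t : MvPolynomial (Fin 4) ℂ))
              (pderiv tc.2 (perPoly (Fin (n + 2)) ℂ))) := by
    rw [Submodule.span_le]
    rintro _ ⟨i, rfl⟩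
    rcases i with (tc | t | tk | tl) | (k | l)
    · -- old row, old column: affine in the corner
      obtain ⟨t, k, l⟩ := tc
      have hd := pb_permanent_submatrix_castSucc_castSucc (B μ⁻¹) (B 0) A (hBA μ⁻¹) (hrows μ⁻¹)
        (hlastrow μ⁻¹) hcorner0 k l
      have key : G₀ (Sum.inl (Sum.inl (t, (k, l)))) + μ • G₁ (Sum.inl (Sum.inl (t, (k, l)))) =
          μ • ((X t : MvPolynomial (Fin 4) ℂ) *
            ((B μ⁻¹).submatrix (Fin.castSucc k).succAbove (Fin.castSucc l).succAbove).permanent) := by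
        simp only [G₀, G₁, Sum.elim_inl, F₁, Q₁, hminor, hd, hBw]
        rw [show lin w = ∑ t : Fin 4, w t • (X t : MvPolynomial (Fin 4) ℂ) from rfl]
        simp only [smul_eq_C_mul, mul_add, ← mul_assoc]
        congr 1
        rw [show (C μ * X t * C μ⁻¹ * ∑ x : Fin 4, C (w x) * X x) =
            (C μ * C μ⁻¹) * ((∑ x : Fin 4, C (w x) * X x) * X t) by ring, ← C_mul,
          mul_inv_cancel₀ hμ0, C_1, one_mul]
      show G₀ _ + μ • G₁ _ ∈ _
      rw [key]
      exact Submodule.smul_mem _ _ (hgen μ⁻¹ t _ _)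
    · -- the corner minor: `per M`
      have key : G₀ (Sum.inl (Sum.inr (Sum.inl t))) + μ • G₁ (Sum.inl (Sum.inr (Sum.inl t))) =
          (X t : MvPolynomial (Fin 4) ℂ) *
            ((B μ⁻¹).submatrix (Fin.last (n + 1)).succAbove (Fin.last (n + 1)).succAbove).permanent := by
        simp only [G₀, G₁, Sum.elim_inr, Sum.elim_inl, F₂, Pi.zero_apply, smul_zero, add_zero, hper,
          pb_submatrix_last_last (B μ⁻¹) A (hBA μ⁻¹)]
      show G₀ _ + μ • G₁ _ ∈ _
      rw [key]
      exact hgen μ⁻¹ t _ _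
    · -- old row, border column
      obtain ⟨t, k⟩ := tk
      have key : G₀ (Sum.inl (Sum.inr (Sum.inr (Sum.inl (t, k))))) + μ • G₁ (Sum.inl (Sum.inr (Sum.inr (Sum.inl (t, k))))) =
          (X t : MvPolynomial (Fin 4) ℂ) *
            ((B μ⁻¹).submatrix (Fin.castSucc k).succAbove (Fin.last (n + 1)).succAbove).permanent := by
        simp only [G₀, G₁, Sum.elim_inr, Sum.elim_inl, F₃, Pi.zero_apply, smul_zero, add_zero, hminor,
          pb_permanent_submatrix_castSucc_last (B μ⁻¹) A (fun j => lin (v j)) (hBA μ⁻¹) (hBv μ⁻¹) k]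
        rfl
      show G₀ _ + μ • G₁ _ ∈ _
      rw [key]
      exact hgen μ⁻¹ t _ _
    · -- border row, old column
      obtain ⟨t, l⟩ := tl
      have key : G₀ (Sum.inl (Sum.inr (Sum.inr (Sum.inr (t, l))))) + μ • G₁ (Sum.inl (Sum.inr (Sum.inr (Sum.inr (t, l))))) =
          (X t : MvPolynomial (Fin 4) ℂ) *
            ((B μ⁻¹).submatrix (Fin.last (n + 1)).succAbove (Fin.castSucc l).succAbove).permanent := by
        simp only [G₀, G₁, Sum.elim_inr, Sum.elim_inl, F₄, Pi.zero_apply, smul_zero, add_zero, hminor,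
          pb_permanent_submatrix_last_castSucc (B μ⁻¹) A (fun i => lin (u i)) (hBA μ⁻¹) (hBu μ⁻¹) l]
        rfl
      show G₀ _ + μ • G₁ _ ∈ _
      rw [key]
      exact hgen μ⁻¹ t _ _
    · -- second order, rows: `Z_k = Σ_l v_l Q_{kl} = Σ_l v_l Per'_{kl} - μ⁻¹ w · Per'_{k,last}`
      have hd : ∀ l : Fin (n + 1),
          ((B 0).submatrix (Fin.castSucc k).succAbove (Fin.castSucc l).succAbove).permanent =
            ((B μ⁻¹).submatrix (Fin.castSucc k).succAbove (Fin.castSucc l).succAbove).permanent -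
              (μ⁻¹ • lin w) * (A.submatrix k.succAbove l.succAbove).permanent := by
        intro l
        rw [pb_permanent_submatrix_castSucc_castSucc (B μ⁻¹) (B 0) A (hBA μ⁻¹) (hrows μ⁻¹) (hlastrow μ⁻¹)
          hcorner0 k l, hBw]
        ring
      have key : G₀ (Sum.inr (Sum.inl k)) + μ • G₁ (Sum.inr (Sum.inl k)) =
          (∑ l : Fin (n + 1), lin (v l) *
              ((B μ⁻¹).submatrix (Fin.castSucc k).succAbove (Fin.castSucc l).succAbove).permanent) -
            (μ⁻¹ • lin w) *
              ((B μ⁻¹).submatrix (Fin.castSucc k).succAbove (Fin.last (n + 1)).succAbove).permanent := by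
        simp only [G₀, G₁, Sum.elim_inr, Sum.elim_inl, Pi.zero_apply, smul_zero, add_zero]
        simp only [FZ, hQ]
        rw [pb_permanent_submatrix_castSucc_last (B μ⁻¹) A (fun j => lin (v j)) (hBA μ⁻¹) (hBv μ⁻¹) k,
          Finset.mul_sum, ← Finset.sum_sub_distrib]
        refine Finset.sum_congr rfl fun l _ => ?_
        rw [hd l]
        ring
      show G₀ _ + μ • G₁ _ ∈ _
      rw [key]
      refine Submodule.sub_mem _ (Submodule.sum_mem _ fun l _ => ?_) ?_
      · rw [show lin (v l) = ∑ t : Fin 4, v l t • (X t : MvPolynomial (Fin 4) ℂ) from rfl, Finset.sum_mul]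
        exact Submodule.sum_mem _ fun t _ => by
          rw [smul_mul_assoc]
          exact Submodule.smul_mem _ _ (hgen μ⁻¹ t _ _)
      · rw [show μ⁻¹ • lin w = μ⁻¹ • ∑ t : Fin 4, w t • (X t : MvPolynomial (Fin 4) ℂ) from rfl, smul_mul_assoc,
          Finset.sum_mul]
        exact Submodule.smul_mem _ _ (Submodule.sum_mem _ fun t _ => by
          rw [smul_mul_assoc]
          exact Submodule.smul_mem _ _ (hgen μ⁻¹ t _ _))
    · -- second order, columns: `Z'_l = Σ_k u_k Q_{kl} = Σ_k u_k Per'_{kl} - μ⁻¹ w · Per'_{last,l}`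
      have hd : ∀ k : Fin (n + 1),
          ((B 0).submatrix (Fin.castSucc k).succAbove (Fin.castSucc l).succAbove).permanent =
            ((B μ⁻¹).submatrix (Fin.castSucc k).succAbove (Fin.castSucc l).succAbove).permanent -
              (μ⁻¹ • lin w) * (A.submatrix k.succAbove l.succAbove).permanent := by
        intro k
        rw [pb_permanent_submatrix_castSucc_castSucc (B μ⁻¹) (B 0) A (hBA μ⁻¹) (hrows μ⁻¹) (hlastrow μ⁻¹)
          hcorner0 k l, hBw]
        ring
      have key : G₀ (Sum.inr (Sum.inr l)) + μ • G₁ (Sum.inr (Sum.inr l)) =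
          (∑ k : Fin (n + 1), lin (u k) *
              ((B μ⁻¹).submatrix (Fin.castSucc k).succAbove (Fin.castSucc l).succAbove).permanent) -
            (μ⁻¹ • lin w) *
              ((B μ⁻¹).submatrix (Fin.last (n + 1)).succAbove (Fin.castSucc l).succAbove).permanent := by
        simp only [G₀, G₁, Sum.elim_inr, Pi.zero_apply, smul_zero, add_zero]
        simp only [FZ', hQ]
        rw [pb_permanent_submatrix_last_castSucc (B μ⁻¹) A (fun i => lin (u i)) (hBA μ⁻¹) (hBu μ⁻¹) l,
          Finset.mul_sum, ← Finset.sum_sub_distrib]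
        refine Finset.sum_congr rfl fun k _ => ?_
        rw [hd k]
        ring
      show G₀ _ + μ • G₁ _ ∈ _
      rw [key]
      refine Submodule.sub_mem _ (Submodule.sum_mem _ fun k _ => ?_) ?_
      · rw [show lin (u k) = ∑ t : Fin 4, u k t • (X t : MvPolynomial (Fin 4) ℂ) from rfl, Finset.sum_mul]
        exact Submodule.sum_mem _ fun t _ => by
          rw [smul_mul_assoc]
          exact Submodule.smul_mem _ _ (hgen μ⁻¹ t _ _)
      · rw [show μ⁻¹ • lin w = μ⁻¹ • ∑ t : Fin 4, w t • (X t : MvPolynomial (Fin 4) ℂ) from rfl, smul_mul_assoc,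
          Finset.sum_mul]
        exact Submodule.smul_mem _ _ (Submodule.sum_mem _ fun t _ => by
          rw [smul_mul_assoc]
          exact Submodule.smul_mem _ _ (hgen μ⁻¹ t _ _))
  calc Module.finrank ℂ _ ≤ Module.finrank ℂ ↥(Submodule.span ℂ (Set.range G₀)) := Submodule.finrank_mono hN
    _ ≤ Module.finrank ℂ ↥(Submodule.span ℂ (Set.range fun i => G₀ i + μ • G₁ i)) := hμ
    _ ≤ _ := Submodule.finrank_mono hGμ

end Summit.ValiantsHypothesis.ValiantsHypothesis.Theorems.ValuativeFlip
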